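import Mathlib
import Summits.NavierStokesRegularity.FluidComputer.BorderedResolventIsolation

/-!
# THEOREM 3-B-NESTED (c)/(d) in resolvent coordinates: simplicity and isolation when the column vector `ṽ` and the row vector `ṽ_h` differ (profile-cert-3 g4, cell `ns-blowup`, 2026-08-26)

HONEST FRAMING (human rulings D-0035/D-0074): nothing here is a claim about Navier–Stokes blow-up.
WHAT THIS IS NOT: not NS evidence. Abstract Hilbert-space theorems; consumer = the NESTED form of
THEOREM 3-B run by all three F5 implementations (cap `SKEWCUT-PAIR.md` §9 (N1)–(N7): bordered operator
`𝔅₀(w, μ) = ((λ̃ − L)w + μṽ, ⟨w, ṽ_h⟩)` with COLUMN `ṽ` (float vector at `K_V > K₀`) and ROW `ṽ_h`; the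
normalisation is `⟨v, ṽ_h⟩ = ⟨ṽ, ṽ_h⟩`). This file is `BorderedResolventIsolation` §2 VERBATIM with the
column vector `vc` and the row vector `vr` decoupled (there `vt` played both roles); the pencil lemmas
(§1 there) already allow an arbitrary functional, and the transfer lemma / Fredholm files are reused.
Resolvent coordinates as there: `R_z = 1 − T − (x₀ − z)S₀ = N + zS₀`, `D(L) = range S₀`.

* `apriori_bound_at_certified_nested` — transfer of the a-priori bound
  `‖(S₀ y, μ)‖ ≤ M‖(R_λ̃ y + μ vc, ⟪vr, S₀ y⟫)‖` to the certified pair (`M⋆ = M/(1 − Mρ)`); the further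
  transfer to nearby `z` is `BorderedResolventIsolation.bordered_injective_at` verbatim (row `vr`); `simple_of_apriori_nested` (3-B (c): `ker R_λ⋆ = span{w⋆}`, no Jordan chain — functional
  `⟪vr, S₀ ·⟫`); `resolventCoord_injective_of_near_nested`, `isUnit_resolventCoord_of_near_nested`,
  `isUnit_resolventCoord_of_lt_rIso_nested` (3-B (d): `R_z` INVERTIBLE for `0 < |z − λ⋆| < (1 − κ)/M`,
  Fredholm alternative).

Mathlib + `BorderedResolventIsolation`; no new definitions. bears_on LADDER-NS N5 / Z4-a(1)(2);
evidence-only for `EpisodeBase` (stmt-NavierStokesRegularity-19179).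
-/

open scoped InnerProductSpace

namespace Summit.NavierStokesRegularity.FluidComputer.BorderedResolventIsolationNested

/-! ## Transfer of the a-priori bound, simplicity, isolation (nested: column `vc`, row `vr`) -/

section Analytic

variable {𝕜 H : Type*} [RCLike 𝕜] [NormedAddCommGroup H] [InnerProductSpace 𝕜 H]

/-- **Transfer of the a-priori bound to the certified pair (3-B (c), first step).** Suppose the
a-priori bound at the float pair, `‖(S₀ y, μ)‖ ≤ M‖(R_λ̃ y + μ ṽ, ⟪ṽ, S₀ y⟫)‖` (3-B (a)), and a pair
`(λ⋆, w⋆)` with `‖S₀ w⋆ − ṽ‖² + |λ⋆ − λ̃|² ≤ ρ²` (the K-B4 ball) and `Mρ < 1`. Then the bordered map at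
the certified pair, `(y, μ) ↦ (R_λ⋆ y + μ S₀w⋆, ⟪ṽ, S₀ y⟫)`, obeys the same bound with
`M⋆ = M/(1 − Mρ)`: its difference from the float one is `((λ⋆ − λ̃)S₀ y + μ(S₀w⋆ − ṽ), 0)`, of norm
`≤ ρ‖(S₀ y, μ)‖` by Cauchy–Schwarz. [folklore] -/
theorem apriori_bound_at_certified_nested (S₀ T : H →L[𝕜] H) (x₀ lt lam : 𝕜) (vc vr ws : H) {M ρ : ℝ}
    (hM : 0 ≤ M) (hρ : 0 ≤ ρ) (hMρ : M * ρ < 1)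
    (hapr : ∀ (y : H) (μ : 𝕜), ‖WithLp.toLp 2 (S₀ y, μ)‖ ≤
      M * ‖WithLp.toLp 2 (((1 : H →L[𝕜] H) - T - (x₀ - lt) • S₀) y + μ • vc, ⟪vr, S₀ y⟫_𝕜)‖)
    (hball : ‖S₀ ws - vc‖ ^ 2 + ‖lam - lt‖ ^ 2 ≤ ρ ^ 2) (y : H) (μ : 𝕜) :
    ‖WithLp.toLp 2 (S₀ y, μ)‖ ≤ M / (1 - M * ρ) *
      ‖WithLp.toLp 2 (((1 : H →L[𝕜] H) - T - (x₀ - lam) • S₀) y + μ • S₀ ws, ⟪vr, S₀ y⟫_𝕜)‖ := by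
  refine BorderedHeadTailBound.apriori_bound_of_perturbation
    (fun x : H × 𝕜 => WithLp.toLp 2 (S₀ x.1, x.2))
    (fun x : H × 𝕜 => WithLp.toLp 2
      (((1 : H →L[𝕜] H) - T - (x₀ - lt) • S₀) x.1 + x.2 • vc, ⟪vr, S₀ x.1⟫_𝕜))
    (fun x : H × 𝕜 => WithLp.toLp 2
      (((1 : H →L[𝕜] H) - T - (x₀ - lam) • S₀) x.1 + x.2 • S₀ ws, ⟪vr, S₀ x.1⟫_𝕜))
    hM (fun x => hapr x.1 x.2) (fun x => ?_) hMρ (y, μ)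
  -- the perturbation: `((lam - lt) • S₀ y + μ • (S₀ ws - vc), 0)`
  have hdiff : WithLp.toLp 2 (((1 : H →L[𝕜] H) - T - (x₀ - lam) • S₀) x.1 + x.2 • S₀ ws,
        ⟪vr, S₀ x.1⟫_𝕜) -
      WithLp.toLp 2 (((1 : H →L[𝕜] H) - T - (x₀ - lt) • S₀) x.1 + x.2 • vc, ⟪vr, S₀ x.1⟫_𝕜) =
      WithLp.toLp 2 ((lam - lt) • S₀ x.1 + x.2 • (S₀ ws - vc), (0 : 𝕜)) := by
    rw [← WithLp.toLp_sub, Prod.mk_sub_mk, sub_self, BorderedResolventIsolation.resolventCoord_apply S₀ T x₀ lam,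
      BorderedResolventIsolation.resolventCoord_apply S₀ T x₀ lt]
    congr 2
    rw [smul_sub, sub_smul]
    abel
  rw [hdiff, WithLp.norm_toLp_fst]
  calc ‖(lam - lt) • S₀ x.1 + x.2 • (S₀ ws - vc)‖
      ≤ ‖lam - lt‖ * ‖S₀ x.1‖ + ‖x.2‖ * ‖S₀ ws - vc‖ := by
        refine (norm_add_le _ _).trans ?_
        rw [norm_smul, norm_smul]
    _ ≤ ρ * ‖WithLp.toLp 2 (S₀ x.1, x.2)‖ :=
        BorderedResolventIsolation.mul_norm_add_norm_mul_le (S₀ x.1) x.2 (norm_nonneg _) (norm_nonneg _) hρ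
          (by rw [add_comm]; exact hball)

/-- **3-B (c) in resolvent coordinates: geometric and algebraic simplicity.** Under the a-priori bound
at the float pair (constant `M`), a certified pair `(λ⋆, w⋆)` with `R_λ⋆ w⋆ = 0` in the ball
`‖S₀w⋆ − ṽ‖² + |λ⋆ − λ̃|² ≤ ρ²`, `Mρ < 1`, and `S₀` injective: every `y` with `R_λ⋆ y = 0` is a multiple
of `w⋆`, and a chain `R_λ⋆ y₁ = S₀ y₂`, `R_λ⋆ y₂ = 0` has `y₂ = 0` — `ker(λ⋆ − L) = span{v⋆}` and no
generalised eigenvector, for the unbounded `L` with `D(L) = range S₀`. [folklore] -/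
theorem simple_of_apriori_nested (S₀ T : H →L[𝕜] H) (hS₀ : Function.Injective S₀) (x₀ lt lam : 𝕜)
    (vc vr ws : H) {M ρ : ℝ} (hM : 0 ≤ M) (hρ : 0 ≤ ρ) (hMρ : M * ρ < 1)
    (hapr : ∀ (y : H) (μ : 𝕜), ‖WithLp.toLp 2 (S₀ y, μ)‖ ≤
      M * ‖WithLp.toLp 2 (((1 : H →L[𝕜] H) - T - (x₀ - lt) • S₀) y + μ • vc, ⟪vr, S₀ y⟫_𝕜)‖)
    (hball : ‖S₀ ws - vc‖ ^ 2 + ‖lam - lt‖ ^ 2 ≤ ρ ^ 2)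
    (hws : ((1 : H →L[𝕜] H) - T - (x₀ - lam) • S₀) ws = 0) :
    (∀ y : H, ((1 : H →L[𝕜] H) - T - (x₀ - lam) • S₀) y = 0 →
        y = (⟪vr, S₀ y⟫_𝕜 / ⟪vr, S₀ ws⟫_𝕜) • ws) ∧
      (∀ y₁ y₂ : H, ((1 : H →L[𝕜] H) - T - (x₀ - lam) • S₀) y₁ = S₀ y₂ →
        ((1 : H →L[𝕜] H) - T - (x₀ - lam) • S₀) y₂ = 0 → y₂ = 0) := by
  have hMs : 0 ≤ M / (1 - M * ρ) := div_nonneg hM (sub_pos.mpr hMρ).le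
  have haprs := apriori_bound_at_certified_nested S₀ T x₀ lt lam vc vr ws hM hρ hMρ hapr hball
  have hinj := BorderedResolventIsolation.bordered_injective_at S₀ T hS₀ x₀ lam lam vr ws hMs
    (by rw [sub_self, norm_zero, mul_zero]; exact one_pos) haprs
  set N : H →ₗ[𝕜] H := (((1 : H →L[𝕜] H) - T - x₀ • S₀) : H →L[𝕜] H).toLinearMap with hN
  set φ : H →ₗ[𝕜] 𝕜 := (innerₛₗ 𝕜 vr).comp S₀.toLinearMap with hφ
  have hinj' : ∀ (y : H) (μ : 𝕜), N y + lam • S₀.toLinearMap y + μ • S₀.toLinearMap ws = 0 →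
      φ y = 0 → y = 0 ∧ μ = 0 := fun y μ h1 h2 => hinj y μ h1 h2
  have hws' : N ws + lam • S₀.toLinearMap ws = 0 := by
    have := hws; rw [BorderedResolventIsolation.resolventCoord_apply] at this; exact this
  refine ⟨fun y hy => ?_, fun y₁ y₂ h1 h2 => ?_⟩
  · have hy' : N y + lam • S₀.toLinearMap y = 0 := by
      rw [BorderedResolventIsolation.resolventCoord_apply] at hy; exact hy
    have := BorderedResolventIsolation.pencil_eq_smul N S₀.toLinearMap φ ws lam hws' hinj' y hy'
    simpa [hφ] using this
  · have h1' : N y₁ + lam • S₀.toLinearMap y₁ = S₀.toLinearMap y₂ := by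
      rw [BorderedResolventIsolation.resolventCoord_apply] at h1; exact h1
    have h2' : N y₂ + lam • S₀.toLinearMap y₂ = 0 := by
      rw [BorderedResolventIsolation.resolventCoord_apply] at h2; exact h2
    exact BorderedResolventIsolation.pencil_chain_eq_zero N S₀.toLinearMap φ ws lam hws' hinj' y₁ y₂ h1' h2'

/-- **3-B (d) in resolvent coordinates, injectivity: no other eigenvalue in the disc.** Under the same
hypotheses, for every `z ≠ λ⋆` with `|z − λ⋆| < (1 − Mρ)/M` the operator `R_z` is injective — `z` is
not an eigenvalue of `L`. [folklore] -/
theorem resolventCoord_injective_of_near_nested (S₀ T : H →L[𝕜] H) (hS₀ : Function.Injective S₀)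
    (x₀ lt lam : 𝕜) (vc vr ws : H) {M ρ : ℝ} (hM : 0 < M) (hρ : 0 ≤ ρ) (hMρ : M * ρ < 1)
    (hapr : ∀ (y : H) (μ : 𝕜), ‖WithLp.toLp 2 (S₀ y, μ)‖ ≤
      M * ‖WithLp.toLp 2 (((1 : H →L[𝕜] H) - T - (x₀ - lt) • S₀) y + μ • vc, ⟪vr, S₀ y⟫_𝕜)‖)
    (hball : ‖S₀ ws - vc‖ ^ 2 + ‖lam - lt‖ ^ 2 ≤ ρ ^ 2)
    (hws : ((1 : H →L[𝕜] H) - T - (x₀ - lam) • S₀) ws = 0)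
    {z : 𝕜} (hz : z ≠ lam) (hnear : ‖z - lam‖ < (1 - M * ρ) / M) :
    Function.Injective ((1 : H →L[𝕜] H) - T - (x₀ - z) • S₀) := by
  have h1M : 0 < 1 - M * ρ := sub_pos.mpr hMρ
  have hMs : 0 ≤ M / (1 - M * ρ) := div_nonneg hM.le h1M.le
  have haprs := apriori_bound_at_certified_nested S₀ T x₀ lt lam vc vr ws hM.le hρ hMρ hapr hball
  have hz' : M / (1 - M * ρ) * ‖z - lam‖ < 1 := by
    rw [div_mul_eq_mul_div, div_lt_one h1M]
    calc M * ‖z - lam‖ < M * ((1 - M * ρ) / M) := mul_lt_mul_of_pos_left hnear hM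
      _ = 1 - M * ρ := mul_div_cancel₀ _ hM.ne'
  have hinj := BorderedResolventIsolation.bordered_injective_at S₀ T hS₀ x₀ lam z vr ws hMs hz' haprs
  set N : H →ₗ[𝕜] H := (((1 : H →L[𝕜] H) - T - x₀ • S₀) : H →L[𝕜] H).toLinearMap with hN
  set φ : H →ₗ[𝕜] 𝕜 := (innerₛₗ 𝕜 vr).comp S₀.toLinearMap with hφ
  have hinj' : ∀ (y : H) (μ : 𝕜), N y + z • S₀.toLinearMap y + μ • S₀.toLinearMap ws = 0 →
      φ y = 0 → y = 0 ∧ μ = 0 := fun y μ h1 h2 => hinj y μ h1 h2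
  have hws' : N ws + lam • S₀.toLinearMap ws = 0 := by
    have := hws; rw [BorderedResolventIsolation.resolventCoord_apply] at this; exact this
  refine (injective_iff_map_eq_zero _).mpr fun y hy => ?_
  have hy' : N y + z • S₀.toLinearMap y = 0 := by
    rw [BorderedResolventIsolation.resolventCoord_apply] at hy; exact hy
  exact BorderedResolventIsolation.pencil_eq_zero_of_ne N S₀.toLinearMap φ ws z lam hws' hz hinj' y hy'

variable [CompleteSpace H]

/-- **3-B (d) in resolvent coordinates: ISOLATION.** With `S₀` compact and injective (free resolvent),
`1 − T` invertible, the a-priori bound at the float pair with constant `M` (3-B (a)), a certified pair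
`(λ⋆, w⋆)`, `R_λ⋆ w⋆ = 0`, in the K-B4 ball of radius `ρ` with `Mρ < 1`: for every `z ≠ λ⋆` with
`|z − λ⋆| < (1 − Mρ)/M` the operator `R_z = 1 − T − (x₀ − z)S₀` is INVERTIBLE — `z − L : D(L) → H` is a
bijection, `z ∈ ρ(L)`: `σ(L) ∩ {|z − λ⋆| < (1 − Mρ)/M} = {λ⋆}`. Injectivity by K-B3′, surjectivity by
the Fredholm alternative (`BorderedResolventFredholm.isUnit_resolventCoord_of_injective`). [folklore] -/
theorem isUnit_resolventCoord_of_near_nested (S₀ T : H →L[𝕜] H) (hS₀c : IsCompactOperator S₀)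
    (hS₀ : Function.Injective S₀) (hT : IsUnit ((1 : H →L[𝕜] H) - T))
    (x₀ lt lam : 𝕜) (vc vr ws : H) {M ρ : ℝ} (hM : 0 < M) (hρ : 0 ≤ ρ) (hMρ : M * ρ < 1)
    (hapr : ∀ (y : H) (μ : 𝕜), ‖WithLp.toLp 2 (S₀ y, μ)‖ ≤
      M * ‖WithLp.toLp 2 (((1 : H →L[𝕜] H) - T - (x₀ - lt) • S₀) y + μ • vc, ⟪vr, S₀ y⟫_𝕜)‖)
    (hball : ‖S₀ ws - vc‖ ^ 2 + ‖lam - lt‖ ^ 2 ≤ ρ ^ 2)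
    (hws : ((1 : H →L[𝕜] H) - T - (x₀ - lam) • S₀) ws = 0)
    {z : 𝕜} (hz : z ≠ lam) (hnear : ‖z - lam‖ < (1 - M * ρ) / M) :
    IsUnit ((1 : H →L[𝕜] H) - T - (x₀ - z) • S₀) :=
  BorderedResolventFredholm.isUnit_resolventCoord_of_injective S₀ T hS₀c hT (x₀ - z)
    (resolventCoord_injective_of_near_nested S₀ T hS₀ x₀ lt lam vc vr ws hM hρ hMρ hapr hball hws hz hnear)

/-- **The printed isolation radius.** The certifiers print `κ = √2·M·ρ` (`= 2√2M²‖r‖`, `ρ = 2M‖r‖`)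
and `r_iso = (1 − κ)/M`; since `Mρ ≤ √2Mρ = κ`, `|z − λ⋆| < r_iso` implies `|z − λ⋆| < (1 − Mρ)/M`,
so `isUnit_resolventCoord_of_near_nested` covers the printed punctured disc: for `κ < 1`, `z ≠ λ⋆`,
`|z − λ⋆| < (1 − κ)/M` ⇒ `R_z` invertible. [folklore] -/
theorem isUnit_resolventCoord_of_lt_rIso_nested (S₀ T : H →L[𝕜] H) (hS₀c : IsCompactOperator S₀)
    (hS₀ : Function.Injective S₀) (hT : IsUnit ((1 : H →L[𝕜] H) - T))
    (x₀ lt lam : 𝕜) (vc vr ws : H) {M ρ : ℝ} (hM : 0 < M) (hρ : 0 ≤ ρ)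
    (hκ : Real.sqrt 2 * M * ρ < 1)
    (hapr : ∀ (y : H) (μ : 𝕜), ‖WithLp.toLp 2 (S₀ y, μ)‖ ≤
      M * ‖WithLp.toLp 2 (((1 : H →L[𝕜] H) - T - (x₀ - lt) • S₀) y + μ • vc, ⟪vr, S₀ y⟫_𝕜)‖)
    (hball : ‖S₀ ws - vc‖ ^ 2 + ‖lam - lt‖ ^ 2 ≤ ρ ^ 2)
    (hws : ((1 : H →L[𝕜] H) - T - (x₀ - lam) • S₀) ws = 0)
    {z : 𝕜} (hz : z ≠ lam) (hnear : ‖z - lam‖ < (1 - Real.sqrt 2 * M * ρ) / M) :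
    IsUnit ((1 : H →L[𝕜] H) - T - (x₀ - z) • S₀) := by
  have h2 : (1 : ℝ) ≤ Real.sqrt 2 := Real.one_le_sqrt.mpr (by norm_num)
  have hMρ' : M * ρ ≤ Real.sqrt 2 * M * ρ := by nlinarith [mul_nonneg hM.le hρ]
  have hMρ : M * ρ < 1 := lt_of_le_of_lt hMρ' hκ
  refine isUnit_resolventCoord_of_near_nested S₀ T hS₀c hS₀ hT x₀ lt lam vc vr ws hM hρ hMρ hapr hball hws hz
    (hnear.trans_le ?_)
  exact div_le_div_of_nonneg_right (by linarith) hM.le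

end Analytic

end Summit.NavierStokesRegularity.FluidComputer.BorderedResolventIsolationNested
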